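import Summits.RiemannHypothesis.RiemannHypothesis.Theorems.SemilocalDeletionAnimalFloor
import HarnessLib

/-!
# The animal floor: two-sided form, the LIOUVILLE TWIST of lattice certificates, and the RH falsifier with the exact constant

Sequel of `SemilocalDeletionAnimalFloor` (p389024: an animal certificate with constant `μ` for the move `S → S'` gives
`Re Q_{S'} ≥ Re Q_S − μ‖g‖₂²` on `C(c)` and `λ_min(S'; c; P) ≥ λ_min(S; c; P) − μ`).

* §1 TWO-SIDED: the reverse move `S' → S` has weights `−w_n`; a certificate for it with constant `μ'` gives `λ_min(S'; c; P) ≤ λ_min(S; c; P) + μ'`,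
  so `|λ_min(S') − λ_min(S)| ≤ max(μ, μ')` (`abs_semilocalGroundEnergy_sub_le_of_animalCerts`).
* §2 ★ THE LIOUVILLE TWIST (pure lattice algebra): twisting a lattice vector by the sign `τ(k) = Π_p (−1)^{k_p}` turns the lattice form with
  weights `w_n` into the form with weights `λ_T(n)·w_n`, `λ_T(n) = Π_{p∈T} (−1)^{v_p(n)}` (= the Liouville sign `(−1)^{Ω(n)}` of a `T`-smooth
  `n`), and preserves the norm: `latticeForm_twist`.  Hence certificates for `w` and for `λ_T·w` have the SAME constants
  (`latticeCert_twist`) — the lattice origin of the cell's Liouville parity rule (gen16 `SemilocalDeletionLiouvilleParity`): optimal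
  animals carry Liouville signs up to the frustration of even powers.
* §3 SINGLE-ATOM REGIME: if every moved atom is a first power (`w_n ≠ 0 ⇒ n` prime), then `λ_T·w = −w` on the support, so a certificate
  for the move `S → S'` with constant `μ` IS a certificate for the reverse move: the deletion is two-sided with ONE sharp constant,
  `|λ_min(S'; c; P) − λ_min(S; c; P)| ≤ μ` (`abs_semilocalGroundEnergy_sub_le_of_animalCert_prime`) — floor constant = ceiling constant
  (= Perron value), the regime of `…PairFloor` / `…SchurFloor`.
* §4 Under RH: `λ_min(S'; c; P) < −μ` for an animal-certificate constant `μ` of the move `S → S'`, `S ⊇` the primes of the window, refutes RH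
  (`not_riemannHypothesis_of_semilocalGroundEnergy_lt_of_animalCert`) — the falsifier with the EXACT joint-floor constant (cc-s2-1 gen17
  lineage Lc certifies such constants to 1e−6 for pairs; the certified lineage-E table passes with slack ≥ 1e−16 in 79/79 cells).

Nothing here bears on the truth of RH.
-/

set_option linter.dupNamespace false

noncomputable section

open Complex Filter Set MeasureTheory Finset
open scoped Real Topology ComplexConjugate

namespace Summit.RiemannHypothesis.RiemannHypothesis.Theorems.SemilocalDeletionAnimalTwist

open Literature.NumberTheory.LFunctions
open Summit.RiemannHypothesis.RiemannHypothesis.Theorems.SemilocalDeletionAnimalFloor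
open Summit.RiemannHypothesis.RiemannHypothesis.Theorems.HandoffSemilocalEnergy

variable {c : ℝ} {N : ℕ} {S S' T : Finset ℕ} {Pc : (ℝ → ℂ) → Prop}

/-! ## §1  Two-sided form -/

/-- **Two-sided move.**  Animal certificates for `S → S'` (weights `Λ_S − Λ_{S'}`, constant `μ ≥ 0`) and for the reverse move `S' → S`
(constant `μ' ≥ 0`) give `|λ_min(S'; c; P) − λ_min(S; c; P)| ≤ max μ μ'`. -/
theorem abs_semilocalGroundEnergy_sub_le_of_animalCerts (hT : ∀ p, p.Prime → p ∈ S → p ∉ S' → p ∈ T)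
    (hT' : ∀ p, p.Prime → p ∈ S' → p ∉ S → p ∈ T) (hN : 2 * c < Real.log ((N : ℝ) + 1)) {μ μ' : ℝ} (hμ : 0 ≤ μ) (hμ' : 0 ≤ μ')
    (hcert : ∀ (u : ℝ) (F : Finset (T → ℤ)) (G : (T → ℤ) → ℂ), (∀ k, k ∉ F → G k = 0) →
      (∀ k ∈ F, u + ∑ p : T, (k p : ℝ) * Real.log ((p : ℕ) : ℝ) ∈ Icc (-c) c) →
      0 ≤ μ * ∑ k ∈ F, ‖G k‖ ^ 2 + ∑ n ∈ Finset.range (N + 1), (weilSemilocalCoeff S n - weilSemilocalCoeff S' n) *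
        ∑ k ∈ F, (G (k + fun p : T ↦ ((n.factorization p : ℕ) : ℤ)) * conj (G k) +
          G k * conj (G (k + fun p : T ↦ ((n.factorization p : ℕ) : ℤ)))).re)
    (hcert' : ∀ (u : ℝ) (F : Finset (T → ℤ)) (G : (T → ℤ) → ℂ), (∀ k, k ∉ F → G k = 0) →
      (∀ k ∈ F, u + ∑ p : T, (k p : ℝ) * Real.log ((p : ℕ) : ℝ) ∈ Icc (-c) c) →
      0 ≤ μ' * ∑ k ∈ F, ‖G k‖ ^ 2 + ∑ n ∈ Finset.range (N + 1), (weilSemilocalCoeff S' n - weilSemilocalCoeff S n) *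
        ∑ k ∈ F, (G (k + fun p : T ↦ ((n.factorization p : ℕ) : ℤ)) * conj (G k) +
          G k * conj (G (k + fun p : T ↦ ((n.factorization p : ℕ) : ℤ)))).re) :
    |semilocalGroundEnergy S' Pc c - semilocalGroundEnergy S Pc c| ≤ max μ μ' := by
  have h1 := semilocalGroundEnergy_ge_of_animalCert (Pc := Pc) hT hT' hN hμ hcert
  have h2 := semilocalGroundEnergy_ge_of_animalCert (Pc := Pc) hT' hT hN hμ' hcert'
  rw [abs_le]
  constructor <;> linarith [le_max_left μ μ', le_max_right μ μ']

/-! ## §2  The Liouville twist of lattice forms -/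

/-- The twist sign `τ(k) = Π_p (−1)^{k_p}` (an integer power of `−1`, as a complex number). -/
theorem twist_mul_self (k : T → ℤ) : (∏ p : T, (-1 : ℂ) ^ (k p)) * (∏ p : T, (-1 : ℂ) ^ (k p)) = 1 := by
  rw [← Finset.prod_mul_distrib, Finset.prod_eq_one]
  intro p _
  rw [← zpow_add₀ (by norm_num : (-1 : ℂ) ≠ 0), ← two_mul, zpow_mul, zpow_ofNat]
  norm_num

/-- `conj τ(k) = τ(k)` (a real sign). -/
theorem conj_twist (k : T → ℤ) : conj (∏ p : T, (-1 : ℂ) ^ (k p)) = ∏ p : T, (-1 : ℂ) ^ (k p) := by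
  rw [map_prod]
  refine Finset.prod_congr rfl fun p _ ↦ ?_
  rw [map_zpow₀, map_neg, map_one]

/-- `‖τ(k)‖ = 1`. -/
theorem norm_twist (k : T → ℤ) : ‖∏ p : T, (-1 : ℂ) ^ (k p)‖ = 1 := by
  rw [norm_prod, Finset.prod_eq_one]
  intro p _
  rw [norm_zpow, norm_neg, norm_one, one_zpow]

/-- Multiplicativity: `τ(k + v) = τ(k)·τ(v)`. -/
theorem twist_add (k v : T → ℤ) :
    (∏ p : T, (-1 : ℂ) ^ ((k + v) p)) = (∏ p : T, (-1 : ℂ) ^ (k p)) * ∏ p : T, (-1 : ℂ) ^ (v p) := by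
  rw [← Finset.prod_mul_distrib]
  refine Finset.prod_congr rfl fun p _ ↦ ?_
  rw [Pi.add_apply, zpow_add₀ (by norm_num : (-1 : ℂ) ≠ 0)]

/-- **LIOUVILLE TWIST of one edge term**: with `G'(k) = τ(k) G(k)` and a shift `v`,
`Re(G'(k+v) conj G'(k) + G'(k) conj G'(k+v)) = τ(v)·Re(G(k+v) conj G(k) + G(k) conj G(k+v))` where `τ(v) = Π_p (−1)^{v_p}` is real. -/
theorem re_pair_twist (G : (T → ℤ) → ℂ) (k v : T → ℤ) :
    ((∏ p : T, (-1 : ℂ) ^ ((k + v) p)) * G (k + v) * conj ((∏ p : T, (-1 : ℂ) ^ (k p)) * G k) +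
        (∏ p : T, (-1 : ℂ) ^ (k p)) * G k * conj ((∏ p : T, (-1 : ℂ) ^ ((k + v) p)) * G (k + v))).re =
      (∏ p : T, (-1 : ℝ) ^ (v p)) * (G (k + v) * conj (G k) + G k * conj (G (k + v))).re := by
  have hτv : (∏ p : T, (-1 : ℂ) ^ (v p)) = ((∏ p : T, (-1 : ℝ) ^ (v p) : ℝ) : ℂ) := by
    push_cast; rfl
  rw [twist_add, map_mul, map_mul, map_mul, conj_twist, conj_twist]
  have e : (∏ p : T, (-1 : ℂ) ^ (k p)) * (∏ p : T, (-1 : ℂ) ^ (v p)) * G (k + v) * ((∏ p : T, (-1 : ℂ) ^ (k p)) * conj (G k)) +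
      (∏ p : T, (-1 : ℂ) ^ (k p)) * G k * ((∏ p : T, (-1 : ℂ) ^ (k p)) * (∏ p : T, (-1 : ℂ) ^ (v p)) * conj (G (k + v))) =
      (∏ p : T, (-1 : ℂ) ^ (v p)) * (((∏ p : T, (-1 : ℂ) ^ (k p)) * ∏ p : T, (-1 : ℂ) ^ (k p)) *
        (G (k + v) * conj (G k) + G k * conj (G (k + v)))) := by ring
  rw [e, twist_mul_self, one_mul, hτv, Complex.re_ofReal_mul]

/-- **THE LIOUVILLE TWIST OF THE LATTICE FORM.**  For any weights `w`, shifts `d`, finite `F` and vector `G`, the twisted vector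
`G'(k) = τ(k)·G(k)` has the same norm and `LF_w(G') = LF_{w'}(G)` with `w'_n = τ(d_n)·w_n`, `τ(d_n) = Π_p (−1)^{(d_n)_p}`. -/
theorem latticeForm_twist (w : ℕ → ℝ) (d : ℕ → T → ℤ) (F : Finset (T → ℤ)) (G : (T → ℤ) → ℂ) (μ : ℝ) :
    μ * ∑ k ∈ F, ‖(∏ p : T, (-1 : ℂ) ^ (k p)) * G k‖ ^ 2 + ∑ n ∈ Finset.range (N + 1), w n *
        ∑ k ∈ F, ((∏ p : T, (-1 : ℂ) ^ ((k + d n) p)) * G (k + d n) * conj ((∏ p : T, (-1 : ℂ) ^ (k p)) * G k) +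
          (∏ p : T, (-1 : ℂ) ^ (k p)) * G k * conj ((∏ p : T, (-1 : ℂ) ^ ((k + d n) p)) * G (k + d n))).re =
      μ * ∑ k ∈ F, ‖G k‖ ^ 2 + ∑ n ∈ Finset.range (N + 1), ((∏ p : T, (-1 : ℝ) ^ (d n p)) * w n) *
        ∑ k ∈ F, (G (k + d n) * conj (G k) + G k * conj (G (k + d n))).re := by
  congr 1
  · congr 1
    exact Finset.sum_congr rfl fun k _ ↦ by rw [norm_mul, norm_twist, one_mul]
  · refine Finset.sum_congr rfl fun n _ ↦ ?_
    rw [mul_assoc, Finset.mul_sum, Finset.mul_sum, Finset.mul_sum]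
    refine Finset.sum_congr rfl fun k _ ↦ ?_
    rw [re_pair_twist]; ring

/-- **Certificates are twist-invariant.**  A lattice certificate with constant `μ` for the weights `τ(d_n)·w_n` yields one with the
same constant for the weights `w_n` (apply it to the twisted vector; the slab condition does not see the twist). -/
theorem latticeCert_twist (w : ℕ → ℝ) (d : ℕ → T → ℤ) {μ : ℝ}
    (hcert : ∀ (u : ℝ) (F : Finset (T → ℤ)) (G : (T → ℤ) → ℂ), (∀ k, k ∉ F → G k = 0) →
      (∀ k ∈ F, u + ∑ p : T, (k p : ℝ) * Real.log ((p : ℕ) : ℝ) ∈ Icc (-c) c) →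
      0 ≤ μ * ∑ k ∈ F, ‖G k‖ ^ 2 + ∑ n ∈ Finset.range (N + 1), ((∏ p : T, (-1 : ℝ) ^ (d n p)) * w n) *
        ∑ k ∈ F, (G (k + d n) * conj (G k) + G k * conj (G (k + d n))).re)
    (u : ℝ) (F : Finset (T → ℤ)) (G : (T → ℤ) → ℂ) (hG : ∀ k, k ∉ F → G k = 0)
    (hF : ∀ k ∈ F, u + ∑ p : T, (k p : ℝ) * Real.log ((p : ℕ) : ℝ) ∈ Icc (-c) c) :
    0 ≤ μ * ∑ k ∈ F, ‖G k‖ ^ 2 + ∑ n ∈ Finset.range (N + 1), w n *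
        ∑ k ∈ F, (G (k + d n) * conj (G k) + G k * conj (G (k + d n))).re := by
  -- apply the certificate to the twisted vector G'(k) = τ(k) G(k) and untwist: τ(d)·(τ(d)·w) = w
  have h := hcert u F (fun k ↦ (∏ p : T, (-1 : ℂ) ^ (k p)) * G k) (fun k hk ↦ by rw [hG k hk, mul_zero]) hF
  rw [latticeForm_twist] at h
  have e : ∀ n, (∏ p : T, (-1 : ℝ) ^ (d n p)) * ((∏ p : T, (-1 : ℝ) ^ (d n p)) * w n) = w n := by
    intro n
    rw [← mul_assoc, ← Finset.prod_mul_distrib, Finset.prod_eq_one (fun p _ ↦ ?_), one_mul]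
    rw [← zpow_add₀ (by norm_num : (-1 : ℝ) ≠ 0), ← two_mul, zpow_mul, zpow_ofNat]; norm_num
  simp only [e] at h
  exact h

/-! ## §3  The single-atom regime: one sharp constant for both directions -/

/-- In the single-atom regime the twist sign of the exponent vector of a prime `p ∈ T` is `−1`. -/
theorem twist_factorization_prime {p : ℕ} (hp : p.Prime) (hpT : p ∈ T) :
    (∏ q : T, (-1 : ℝ) ^ (((p.factorization q : ℕ) : ℤ))) = -1 := by
  rw [Finset.prod_eq_single ⟨p, hpT⟩, hp.factorization]
  · simp
  · intro q _ hq
    have : (q : ℕ) ≠ p := fun h ↦ hq (Subtype.ext h)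
    rw [hp.factorization, Finsupp.single_apply, if_neg (Ne.symm this)]
    simp
  · intro h; exact absurd (Finset.mem_univ _) h

/-- A prime whose deleted/added weight is nonzero lies in exactly one of `S`, `S'`, hence in `T`. -/
theorem mem_of_coeff_sub_ne_zero_prime (hT : ∀ p, p.Prime → p ∈ S → p ∉ S' → p ∈ T)
    (hT' : ∀ p, p.Prime → p ∈ S' → p ∉ S → p ∈ T) {p : ℕ} (hp : p.Prime)
    (hw : weilSemilocalCoeff S p - weilSemilocalCoeff S' p ≠ 0) : p ∈ T := by
  unfold weilSemilocalCoeff at hw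
  simp only [hp.primeFactors, Finset.singleton_subset_iff] at hw
  by_cases h1 : p ∈ S <;> by_cases h2 : p ∈ S'
  · simp [h1, h2] at hw
  · exact hT p hp h1 h2
  · exact hT' p hp h2 h1
  · simp [h1, h2] at hw

/-- **SINGLE-ATOM REGIME: one sharp constant both ways.**  If every moved atom is a first power (`w_n ≠ 0 ⇒ n` prime, i.e. `c < log p`
for the moved primes), an animal certificate with constant `μ ≥ 0` for `S → S'` gives `|λ_min(S'; c; P) − λ_min(S; c; P)| ≤ μ`. -/
theorem abs_semilocalGroundEnergy_sub_le_of_animalCert_prime (hT : ∀ p, p.Prime → p ∈ S → p ∉ S' → p ∈ T)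
    (hT' : ∀ p, p.Prime → p ∈ S' → p ∉ S → p ∈ T) (hN : 2 * c < Real.log ((N : ℝ) + 1)) {μ : ℝ} (hμ : 0 ≤ μ)
    (hprime : ∀ n ∈ Finset.range (N + 1), weilSemilocalCoeff S n - weilSemilocalCoeff S' n ≠ 0 → n.Prime)
    (hcert : ∀ (u : ℝ) (F : Finset (T → ℤ)) (G : (T → ℤ) → ℂ), (∀ k, k ∉ F → G k = 0) →
      (∀ k ∈ F, u + ∑ p : T, (k p : ℝ) * Real.log ((p : ℕ) : ℝ) ∈ Icc (-c) c) →
      0 ≤ μ * ∑ k ∈ F, ‖G k‖ ^ 2 + ∑ n ∈ Finset.range (N + 1), (weilSemilocalCoeff S n - weilSemilocalCoeff S' n) *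
        ∑ k ∈ F, (G (k + fun p : T ↦ ((n.factorization p : ℕ) : ℤ)) * conj (G k) +
          G k * conj (G (k + fun p : T ↦ ((n.factorization p : ℕ) : ℤ)))).re) :
    |semilocalGroundEnergy S' Pc c - semilocalGroundEnergy S Pc c| ≤ μ := by
  -- the reverse weights −w equal τ(v(n))·(−w)·(−1)… precisely τ(v(n))·(Λ_{S'} − Λ_S)(n) = (Λ_S − Λ_{S'})(n) termwise
  have hwt : ∀ n ∈ Finset.range (N + 1),
      (∏ q : T, (-1 : ℝ) ^ (((n.factorization q : ℕ) : ℤ))) * (weilSemilocalCoeff S' n - weilSemilocalCoeff S n) =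
        weilSemilocalCoeff S n - weilSemilocalCoeff S' n := by
    intro n hn
    by_cases h0 : weilSemilocalCoeff S n - weilSemilocalCoeff S' n = 0
    · have : weilSemilocalCoeff S' n - weilSemilocalCoeff S n = 0 := by linarith
      rw [this, h0, mul_zero]
    · have hp := hprime n hn h0
      rw [twist_factorization_prime (T := T) hp (mem_of_coeff_sub_ne_zero_prime hT hT' hp h0)]
      ring
  have hcert' : ∀ (u : ℝ) (F : Finset (T → ℤ)) (G : (T → ℤ) → ℂ), (∀ k, k ∉ F → G k = 0) →
      (∀ k ∈ F, u + ∑ p : T, (k p : ℝ) * Real.log ((p : ℕ) : ℝ) ∈ Icc (-c) c) →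
      0 ≤ μ * ∑ k ∈ F, ‖G k‖ ^ 2 + ∑ n ∈ Finset.range (N + 1), (weilSemilocalCoeff S' n - weilSemilocalCoeff S n) *
        ∑ k ∈ F, (G (k + fun p : T ↦ ((n.factorization p : ℕ) : ℤ)) * conj (G k) +
          G k * conj (G (k + fun p : T ↦ ((n.factorization p : ℕ) : ℤ)))).re := by
    intro u F G hG hF
    refine latticeCert_twist (c := c) (N := N) (fun n ↦ weilSemilocalCoeff S' n - weilSemilocalCoeff S n)
      (fun n ↦ fun p : T ↦ ((n.factorization p : ℕ) : ℤ)) (μ := μ) (fun u F G hG hF ↦ ?_) u F G hG hF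
    have h := hcert u F G hG hF
    have key : ∀ n ∈ Finset.range (N + 1),
        (∏ q : T, (-1 : ℝ) ^ (((n.factorization q : ℕ) : ℤ))) * (weilSemilocalCoeff S' n - weilSemilocalCoeff S n) *
            ∑ k ∈ F, (G (k + fun p : T ↦ ((n.factorization p : ℕ) : ℤ)) * conj (G k) +
              G k * conj (G (k + fun p : T ↦ ((n.factorization p : ℕ) : ℤ)))).re =
          (weilSemilocalCoeff S n - weilSemilocalCoeff S' n) *
            ∑ k ∈ F, (G (k + fun p : T ↦ ((n.factorization p : ℕ) : ℤ)) * conj (G k) +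
              G k * conj (G (k + fun p : T ↦ ((n.factorization p : ℕ) : ℤ)))).re := fun n hn ↦ by
      rw [hwt n hn]
    rw [Finset.sum_congr rfl key]
    exact h
  have h := abs_semilocalGroundEnergy_sub_le_of_animalCerts (Pc := Pc) hT hT' hN hμ hμ hcert hcert'
  rwa [max_self] at h

/-! ## §4  Under RH: the falsifier with the exact joint-floor constant -/

/-- **FALSIFIER (animal constant).**  `S ⊇` the primes of every prime power `≤ N` (the window form is Weil's form), `0 < c`, `2c < log(N+1)`,
an animal certificate with constant `μ ≥ 0` for the move `S → S'`, a scaling-stable constraint `P`: a bottom `λ_min(S'; c; P) < −μ`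
refutes RH.  (The exact constant `μ*_{S∆S'}(c)` is the sharpest such `μ`; lineage Lc certifies it for pairs.) -/
theorem not_riemannHypothesis_of_semilocalGroundEnergy_lt_of_animalCert (hS : ∀ n ≤ N, IsPrimePow n → n.primeFactors ⊆ S)
    (hT : ∀ p, p.Prime → p ∈ S → p ∉ S' → p ∈ T) (hT' : ∀ p, p.Prime → p ∈ S' → p ∉ S → p ∈ T)
    (hc : 0 < c) (hN : 2 * c < Real.log ((N : ℝ) + 1)) {μ : ℝ} (hμ : 0 ≤ μ)
    (hcert : ∀ (u : ℝ) (F : Finset (T → ℤ)) (G : (T → ℤ) → ℂ), (∀ k, k ∉ F → G k = 0) →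
      (∀ k ∈ F, u + ∑ p : T, (k p : ℝ) * Real.log ((p : ℕ) : ℝ) ∈ Icc (-c) c) →
      0 ≤ μ * ∑ k ∈ F, ‖G k‖ ^ 2 + ∑ n ∈ Finset.range (N + 1), (weilSemilocalCoeff S n - weilSemilocalCoeff S' n) *
        ∑ k ∈ F, (G (k + fun p : T ↦ ((n.factorization p : ℕ) : ℤ)) * conj (G k) +
          G k * conj (G (k + fun p : T ↦ ((n.factorization p : ℕ) : ℤ)))).re)
    (hP : ∀ (a : ℝ) (g : ℝ → ℂ), 0 < a → Pc g → Pc fun t ↦ (a : ℂ) * g t)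
    (hlt : semilocalGroundEnergy S' Pc c < -μ) : ¬ Summit.RiemannHypothesis := by
  intro hRH
  have hW : WeilPositivityOn c := (riemannHypothesis_iff_forall_weilPositivityOn.1 (Summit.RiemannHypothesis_iff.1 hRH)) c hc
  have hposS : WeilSemilocalPositivityOn S c :=
    (MotivicDoor.Semilocal.weilSemilocalPositivityOn_iff_weilPositivityOn_of_le hS (by linarith)).2 hW
  have h0 : 0 ≤ semilocalGroundEnergy S Pc c := (semilocalGroundEnergy_nonneg_iff hP).2 fun g hg hs _ ↦ hposS g hg hs
  have h1 := semilocalGroundEnergy_ge_of_animalCert (Pc := Pc) hT hT' hN hμ hcert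
  linarith

end Summit.RiemannHypothesis.RiemannHypothesis.Theorems.SemilocalDeletionAnimalTwist

end
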